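import Literature.AlgebraicGeometry.Motives.AbelianVarietyIsogenyPullbackPushforward
import Literature.AlgebraicGeometry.Motives.AbelianVarietyTranslationFree
import Literature.AlgebraicGeometry.Motives.AbelianVarietyKernelComponent
import Literature.AlgebraicGeometry.Motives.AbelianVarietyFrobeniusCharpolyRigidity
import Literature.AlgebraicGeometry.Motives.AbelianVarietyIsogenyKernelDeterminesQuotient
import Literature.AlgebraicGeometry.Modules.PullbackPushforwardGaloisChart
import HarnessLib

/-!
# `g^*(g_*F) ≅ ∐_{x ∈ Ker g} τ_x^*F` for an isogeny: reduction to the invariants on affine charts of `B`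

Layer `Literature/AlgebraicGeometry/Motives`, namespace `Literature.AlgebraicGeometry.Motives.AbelianVariety`.
(Typing debt of cell `pub-hodge-ring2`, R13.62 (2), towards `IsogenyPullbackPushforwardDecomposition_holds`: research route
conditional on HC_CM; not a corollary; Q11.4-sentence-2 already refuted in dim ≥ 3.)

For an isogeny `g : A → B` of complex abelian varieties the kernel points `x ∈ Ker g(ℂ)` act on `A` over `B` by the
translations `τ_x = t_x` (`kerTranslation`, `kerTranslation_comp : t_x ≫ g = g` — the tree's `translation_comp_eq_self`),
a finite group action (`kerTranslation_one`, `kerTranslation_mul`), free on every affine chart `g⁻¹V`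
(`chartFree_kerTranslation`: the tree's `span_range_translation_appLE_sub_eq_top`). By the sheaf-and-chart theorem
`Literature.AlgebraicGeometry.Modules.nonempty_pullback_pushforward_iso_sigma_of_galoisCharts` (module
Chase–Harrison–Rosenberg on the charts, Greither LNM 1534 Ch. 0 Thm. 1.6; Mumford §7 Thm. 4 / §12 Thm. 1) the decomposition
**`g^*(g_*F) ≅ ∐_{x ∈ Ker g(ℂ)} t_x^*F`** for a vector bundle `F` therefore follows from the single remaining chart statement

  `(Inv)` every point of `B` has an affine neighbourhood `V` over which the `Ker g(ℂ)`-invariant functions on `g⁻¹V` come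
  from `V`: `Γ(B, V) ↠ Γ(A, g⁻¹V)^{Ker g(ℂ)}` (`ChartInvariants`) — i.e. "`B = A / Ker g`" on functions (Mumford §7 Thm. 4 with
  the Theorem on p. 66: `Γ(U, 𝒪_{X/G}) = Γ(π⁻¹U, 𝒪_X)^G`),

which is what `nonempty_pullback_pushforward_iso_sigma_of_chartInvariants` and
`isogenyPullbackPushforwardDecomposition_of_chartInvariants` record. Since `(Inv)` is stable under isomorphisms of the base
(`chartInvariants_comp_iso`, `exists_chartInvariants_comp_iso`) and every complex isogeny is the quotient by its kernel
(`IsIsogeny.exists_torsionQuot_iso_comp_eq`: `g = π ≫ e` with `π : A → A/Ker g` the tree's `torsionQuotHom` and `e` an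
isomorphism), it moreover suffices to know `(Inv)` for the quotient maps `π : A → A/S` of the tree's quotient construction
(`isogenyPullbackPushforwardDecomposition_of_torsionQuot_chartInvariants`), where it is the statement
`Γ(U, 𝒪_{A/S}) = Γ(π⁻¹U, 𝒪_A)^S` built into `AbelianVariety.torsionQuot = Spec` of the invariants (`SubringDatum.toSpec_app_preimage`;
discharged in the sequel).

## References

* [MumfordAV1970] D. Mumford, *Abelian Varieties* (1970), §7 Thm. p. 66 and Thm. 4 (p. 72), §12 Thm. 1 (p. 111).
* [Greither1992CyclicGalois] C. Greither, LNM 1534 (1992), Ch. 0 Thm. 1.6, Lemma 1.10.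
* [GortzWedhorn2023] U. Görtz, T. Wedhorn, *Algebraic Geometry II* (2023), Def./Rem. 27.1, Prop. 27.62.
-/

noncomputable section

universe u

open CategoryTheory CategoryTheory.Limits AlgebraicGeometry TopologicalSpace

namespace Literature.AlgebraicGeometry.Motives

namespace AbelianVariety

open scoped MonObj
open Literature.AlgebraicGeometry.Modules

variable {A B : AbelianVariety ℂ} (g : A ⟶ B)

/-- A subgroup `S ⊆ A(ℂ)` acts on the scheme `A` by the translations `t_s`, `s ∈ S`.
[cite: GortzWedhorn2023, Def./Rem. 27.1 (p. 799)] -/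
def subgroupTranslation (A : AbelianVariety ℂ) (S : Subgroup (A.Points ℂ)) (s : S) : A.X.left ⟶ A.X.left :=
  (A.translation s.1).left

/-- `t_1 = 𝟙`. [cite: GortzWedhorn2023, Def./Rem. 27.1 (p. 799)] -/
theorem subgroupTranslation_one (A : AbelianVariety ℂ) (S : Subgroup (A.Points ℂ)) :
    subgroupTranslation A S 1 = 𝟙 A.X.left := by
  change (A.translation (1 : A.Points ℂ)).left = _
  rw [translation_one]
  rfl

/-- `t_{s s'} = t_s ≫ t_{s'}` (`A` is commutative). [cite: GortzWedhorn2023, Def./Rem. 27.1 (p. 799)] -/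
theorem subgroupTranslation_mul (A : AbelianVariety ℂ) (S : Subgroup (A.Points ℂ)) (s s' : S) :
    subgroupTranslation A S (s * s') = subgroupTranslation A S s ≫ subgroupTranslation A S s' := by
  change (A.translation (s.1 * s'.1)).left = (A.translation s.1 ≫ A.translation s'.1).left
  rw [translation_comp']

/-- The translations by a subgroup `S` killed by `g` are over `B`: `t_s ≫ g = g`. [cite: MumfordAV1970, §7 Thm. 4 (p. 72)] -/
theorem subgroupTranslation_comp {S : Subgroup (A.Points ℂ)} (hS : ∀ s ∈ S, s ≫ g.hom.hom.hom = 1) (s : S) :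
    subgroupTranslation A S s ≫ Hom.toSchemeHom g = Hom.toSchemeHom g :=
  congrArg CommaMorphism.left (translation_comp_eq_self g s.1 (hS s.1 s.2))

/-- The kernel points `Ker g(ℂ)` act on `A` over `B` by the translations `τ_x = t_x`.
[cite: GortzWedhorn2023, Def. 27.1 (p. 799)] -/
abbrev kerTranslation (x : Hom.kerPoints (specOver ℂ ℂ) g) : A.X.left ⟶ A.X.left :=
  subgroupTranslation A (Hom.kerPoints (specOver ℂ ℂ) g) x

/-- The kernel translations are over `B`: `t_x ≫ g = g` for `g(x) = e`. [cite: MumfordAV1970, §7 Thm. 4 (p. 72)] -/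
theorem kerTranslation_comp (x : Hom.kerPoints (specOver ℂ ℂ) g) :
    kerTranslation g x ≫ Hom.toSchemeHom g = Hom.toSchemeHom g :=
  subgroupTranslation_comp g (fun s hs => (Hom.mem_kerPoints_iff g s).1 hs) x

/-- The kernel translations of the quotient map `π : A → A/S` are over `A/S`. [cite: MumfordAV1970, §7 Thm. 4 (p. 72)] -/
theorem subgroupTranslation_comp_torsionQuotHom (A : AbelianVariety ℂ) {n : ℕ} (hn : n ≠ 0) (S : Subgroup (A.Points ℂ))
    (hS : S ≤ A.torsionPoints ℂ n) (s : S) :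
    subgroupTranslation A S s ≫ Hom.toSchemeHom (A.torsionQuotHom hn S hS) = Hom.toSchemeHom (A.torsionQuotHom hn S hS) :=
  subgroupTranslation_comp _ (fun _ hs => A.comp_torsionQuotHom_eq_one hn S hS hs) s

/-- **The kernel translations act freely on the affine charts `g⁻¹V`** (`ChartFree`): for `x ≠ 1` the `t_x♯ b - b` generate
the unit ideal of `Γ(A, g⁻¹V)` (`span_range_translation_appLE_sub_eq_top`). [cite: MumfordAV1970, §7 Thm. 4 (p. 72)]
[cite: Greither1992CyclicGalois, Ch. 0 Thm. 1.6 (i) (pp. 3–4)] -/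
theorem chartFree_kerTranslation (hg : IsIsogeny g) {V : B.X.left.Opens} (hV : IsAffineOpen V) :
    ChartFree (Hom.toSchemeHom g) (kerTranslation g) (kerTranslation_comp g) V := by
  haveI := hg.2
  intro x hx
  exact A.span_range_translation_appLE_sub_eq_top (hV.preimage (Hom.toSchemeHom g)) x.1
    (fun h => hx (Subtype.ext h)) _

/-- **`g^*(g_*F) ≅ ∐_{x ∈ Ker g(ℂ)} t_x^*F` from the invariants on charts**: for an isogeny `g : A → B` of complex abelian
varieties and a vector bundle `F` on `A`, if every point of `B` has an affine neighbourhood `V` with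
`Γ(B, V) ↠ Γ(A, g⁻¹V)^{Ker g(ℂ)}` (`ChartInvariants` for the kernel translations), then `g^*g_*F ≅ ∐_x t_x^*F`
(`nonempty_pullback_pushforward_iso_sigma_of_galoisCharts` with `chartFree_kerTranslation`).
[cite: MumfordAV1970, §7 Thm. 4 (p. 72) and §12 Thm. 1 (p. 111)] [cite: Greither1992CyclicGalois, Ch. 0 Thm. 1.6, Lemma 1.10] -/
theorem nonempty_pullback_pushforward_iso_sigma_of_chartInvariants (hg : IsIsogeny g) (F : A.X.left.Modules)
    (hF : IsFiniteLocallyFree F)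
    (hinv : ∀ y : B.X.left, ∃ V : B.X.left.Opens, y ∈ V ∧ IsAffineOpen V ∧
      ChartInvariants (Hom.toSchemeHom g) (kerTranslation g) (kerTranslation_comp g) V) :
    Nonempty ((Scheme.Modules.pullback (Hom.toSchemeHom g)).obj
        ((Scheme.Modules.pushforward (Hom.toSchemeHom g)).obj F) ≅
      ∐ fun x : Hom.kerPoints (specOver ℂ ℂ) g => (Scheme.Modules.pullback (A.translation x.1).left).obj F) := by
  haveI := hg.2
  haveI : Finite (Hom.kerPoints (specOver ℂ ℂ) g) := finite_kerPoints_of_isFinite g ℂ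
  letI : Fintype (Hom.kerPoints (specOver ℂ ℂ) g) := Fintype.ofFinite _
  have hF' : IsAffineLocalizing F := by
    haveI := hF.isVectorBundle.1
    exact IsAffineLocalizing.of_isQuasicoherent F
  exact nonempty_pullback_pushforward_iso_sigma_of_galoisCharts (Hom.toSchemeHom g) (kerTranslation g)
    (kerTranslation_comp g) (subgroupTranslation_one A _) (subgroupTranslation_mul A _) F hF' fun y => by
      obtain ⟨V, hyV, hV, hin⟩ := hinv y
      exact ⟨V, hyV, hV, chartFree_kerTranslation g hg hV, hin⟩

/-- **Reduction of the named fact to the invariants on charts**: `IsogenyPullbackPushforwardDecomposition` follows from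
`(Inv)` — for every complex isogeny `g : A → B`, every point of `B` has an affine neighbourhood `V` with
`Γ(B, V) ↠ Γ(A, g⁻¹V)^{Ker g(ℂ)}` ("`B = A / Ker g`" on functions, Mumford §7 Thm. 4 with the Theorem on p. 66).
[cite: MumfordAV1970, §7 Thm. p. 66 and Thm. 4 (p. 72)] -/
theorem isogenyPullbackPushforwardDecomposition_of_chartInvariants
    (H : ∀ (A B : AbelianVariety ℂ) (g : A ⟶ B), IsIsogeny g → ∀ y : B.X.left, ∃ V : B.X.left.Opens, y ∈ V ∧
      IsAffineOpen V ∧ ChartInvariants (Hom.toSchemeHom g) (kerTranslation g) (kerTranslation_comp g) V) :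
    IsogenyPullbackPushforwardDecomposition := fun A B g hg F hF =>
  nonempty_pullback_pushforward_iso_sigma_of_chartInvariants g hg F hF (H A B g hg)

/-! ### Transport of `(Inv)` along an isomorphism of the base, and reduction to the quotient maps `A → A/S` -/

/-- `ChartInvariants` only depends on the morphism `g` (transport along an equality of morphisms `g = g'`).
[cite: Greither1992CyclicGalois, Ch. 0 Lemma 1.10 (p. 5)] -/
theorem chartInvariants_congr {X Y : Scheme.{u}} {g g' : X ⟶ Y} (hgg' : g = g') {K : Type u} (τ : K → (X ⟶ X))
    (hτ : ∀ x, τ x ≫ g = g) (hτ' : ∀ x, τ x ≫ g' = g') (V : Y.Opens) :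
    ChartInvariants g τ hτ V ↔ ChartInvariants g' τ hτ' V := by
  subst hgg'
  exact Iff.rfl

/-- **`(Inv)` is stable under isomorphisms of the base**: if the `τ`-invariants of `Γ(X, q⁻¹(e⁻¹V))` come from `e⁻¹V ⊆ Y'`,
then the `τ`-invariants of `Γ(X, (q ≫ e)⁻¹V)` come from `V ⊆ Y` (`e : Y' ≅ Y`). [cite: Greither1992CyclicGalois, Ch. 0 Lemma 1.10 (p. 5)] -/
theorem chartInvariants_comp_iso {X Y' Y : Scheme.{u}} (q : X ⟶ Y') (e : Y' ≅ Y) {K : Type u} (τ : K → (X ⟶ X))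
    (hτq : ∀ x, τ x ≫ q = q) (hτ : ∀ x, τ x ≫ (q ≫ e.hom) = q ≫ e.hom) {V : Y.Opens}
    (h : ChartInvariants q τ hτq (e.hom ⁻¹ᵁ V)) : ChartInvariants (q ≫ e.hom) τ hτ V := by
  intro b hb
  obtain ⟨r', hr'⟩ := h b fun x => hb x
  refine ⟨inv (e.hom.app V) r', ?_⟩
  change (q.app (e.hom ⁻¹ᵁ V)) ((e.hom.app V) ((inv (e.hom.app V)) r')) = b
  rw [CategoryTheory.IsIso.inv_hom_id_apply]
  exact hr'

/-- **`(Inv)` on an affine cover transports along an isomorphism of the base** (`e : Y' ≅ Y`; the chart at `y` is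
`e (V')` for a chart `V'` at `e⁻¹ y`). [cite: Greither1992CyclicGalois, Ch. 0 Lemma 1.10 (p. 5)] -/
theorem exists_chartInvariants_comp_iso {X Y' Y : Scheme.{u}} (q : X ⟶ Y') (e : Y' ≅ Y) {K : Type u}
    (τ : K → (X ⟶ X)) (hτq : ∀ x, τ x ≫ q = q) (hτ : ∀ x, τ x ≫ (q ≫ e.hom) = q ≫ e.hom)
    (h : ∀ y' : Y', ∃ V' : Y'.Opens, y' ∈ V' ∧ IsAffineOpen V' ∧ ChartInvariants q τ hτq V') (y : Y) :
    ∃ V : Y.Opens, y ∈ V ∧ IsAffineOpen V ∧ ChartInvariants (q ≫ e.hom) τ hτ V := by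
  obtain ⟨V', hy', hV', hinv⟩ := h (e.inv.base y)
  refine ⟨e.inv ⁻¹ᵁ V', hy', hV'.preimage_of_isIso e.inv, chartInvariants_comp_iso q e τ hτq hτ ?_⟩
  have hVV : e.hom ⁻¹ᵁ (e.inv ⁻¹ᵁ V') = V' := by
    rw [← Scheme.Hom.comp_preimage, e.hom_inv_id]
    rfl
  rw [hVV]
  exact hinv

/-- The isomorphism of underlying schemes of an isomorphism of abelian varieties. [cite: MumfordAV1970, §7 Thm. 4 (p. 72)] -/
def schemeIsoOfIso {B C : AbelianVariety ℂ} (e : B ≅ C) : B.X.left ≅ C.X.left where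
  hom := Hom.toSchemeHom e.hom
  inv := Hom.toSchemeHom e.inv
  hom_inv_id := by
    change Hom.toSchemeHom (e.hom ≫ e.inv) = _
    rw [e.hom_inv_id]
    rfl
  inv_hom_id := by
    change Hom.toSchemeHom (e.inv ≫ e.hom) = _
    rw [e.inv_hom_id]
    rfl

/-- **Reduction of the named fact to the quotient maps**: `IsogenyPullbackPushforwardDecomposition` follows from `(Inv)` for
the quotient isogenies `π : A → A/S` of the tree (`AbelianVariety.torsionQuotHom`, `S ⊆ A[n](ℂ)`) acting by the translations
`t_s`, `s ∈ S` — every complex isogeny being `π ≫ e` with `e : A/Ker g ≅ B` (`IsIsogeny.exists_torsionQuot_iso_comp_eq`).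
[cite: MumfordAV1970, §7 Thm. p. 66 and Thm. 4 (p. 72)] -/
theorem isogenyPullbackPushforwardDecomposition_of_torsionQuot_chartInvariants
    (H : ∀ (A : AbelianVariety ℂ) (n : ℕ) (hn : n ≠ 0) (S : Subgroup (A.Points ℂ)) (hS : S ≤ A.torsionPoints ℂ n),
      ∀ y : (A.torsionQuot hn S hS).X.left, ∃ V : (A.torsionQuot hn S hS).X.left.Opens, y ∈ V ∧ IsAffineOpen V ∧
        ChartInvariants (Hom.toSchemeHom (A.torsionQuotHom hn S hS)) (subgroupTranslation A S)
          (subgroupTranslation_comp_torsionQuotHom A hn S hS) V) :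
    IsogenyPullbackPushforwardDecomposition := by
  refine isogenyPullbackPushforwardDecomposition_of_chartInvariants fun A B g hg => ?_
  obtain ⟨e, he⟩ := hg.exists_torsionQuot_iso_comp_eq
  have hgg' : Hom.toSchemeHom (A.torsionQuotHom hg.kerRank_ne_zero _ hg.kerPoints_le_torsionPoints_kerRank) ≫
      (schemeIsoOfIso e).hom = Hom.toSchemeHom g :=
    congrArg Hom.toSchemeHom he
  have hτ' : ∀ x : Hom.kerPoints (specOver ℂ ℂ) g, kerTranslation g x ≫
      (Hom.toSchemeHom (A.torsionQuotHom hg.kerRank_ne_zero _ hg.kerPoints_le_torsionPoints_kerRank) ≫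
        (schemeIsoOfIso e).hom) =
      Hom.toSchemeHom (A.torsionQuotHom hg.kerRank_ne_zero _ hg.kerPoints_le_torsionPoints_kerRank) ≫
        (schemeIsoOfIso e).hom := fun x => by
    rw [← Category.assoc, subgroupTranslation_comp_torsionQuotHom]
  intro y
  obtain ⟨V, hyV, hV, hinv⟩ := exists_chartInvariants_comp_iso _ (schemeIsoOfIso e) (kerTranslation g)
    (subgroupTranslation_comp_torsionQuotHom A hg.kerRank_ne_zero _ hg.kerPoints_le_torsionPoints_kerRank) hτ'
    (H A _ hg.kerRank_ne_zero _ hg.kerPoints_le_torsionPoints_kerRank) y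
  exact ⟨V, hyV, hV, (chartInvariants_congr hgg' (kerTranslation g) hτ' (kerTranslation_comp g) V).1 hinv⟩

end AbelianVariety

end Literature.AlgebraicGeometry.Motives

end
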